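import Literature.MathematicalPhysics.QuantumManyBody.PeriodicBoseGasFracEnergy
import Literature.MathematicalPhysics.QuantumManyBody.OneParticleMarginals
import Literature.MathematicalPhysics.QuantumManyBody.BoseGasMergeOccupation
import Literature.MathematicalPhysics.QuantumManyBody.LiebYngvasonBoxBound
import Literature.MathematicalPhysics.QuantumManyBody.DyadicCoherentFractionRefinement
import Literature.MathematicalPhysics.QuantumManyBody.NeumannMomentumCutoffs
import Literature.MathematicalPhysics.QuantumManyBody.BoseGasProductState

/-!
# `BecDepletionCounting` (stmt-AtomisticToContinuum-9034), helper file 1/3: the inner-cube sum rule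

Route `BECInfraredBound` of `AtomisticToContinuum/BoseEinsteinCondensation`, mode-counting glue piece 3/3,
line `translate-traced-parseval` of the crux chain (kernel-checked candidate of the crux ideator, landed by
the line lead). This file proves the first of the two analytic inputs of the counting step:

* `occupation_translate` (the lever): the occupation `⟨φ, γ_Ψ φ⟩` is invariant under the joint translation
  `φ ↦ φ(· − a)`, `Ψ ↦ Ψ(· − (a,…,a))` (Lebesgue measure is translation invariant, fibrewise and in the
  spectators);
* `occupation_phase_mul_mode`: a unit phase on the mode does not change the occupation;
* `tsum_occupation_cellMode_eq` (free-spectator traced Parseval on the origin cell `[0,L)³`):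
  `∑_{p ∈ ℤ³} ⟨1_cell φ_p, γ_Ψ 1_cell φ_p⟩ = (n+1) ∫ 1_cell(x₀) |Ψ(X)|² dX` for continuous `Ψ`, from the
  one-body Parseval identity `Literature.…BoseGas.tsum_sq_cellFourierCoeff` applied in every fibre and
  Tonelli;
* `innerMode_eq`: the crux's literal plane wave of the (half-open) inner cube `∏ [εL, L−εL)` of index `k`
  is a unit phase times the translate by `εL·𝟙` of the cell mode of side `(1−2ε)L`;
* `tsum_occupation_innerMode_eq` (INNER-CUBE SUM RULE): for every continuous `(n+1)`-body `Ψ`,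
  `∑_{k ∈ ℤ³} ⟨φ'_k, γ_Ψ φ'_k⟩ = (n+1) ∫ 1_S(x₀) |Ψ(X)|² dX`, `S = ∏ [εL, L−εL)`.

References: LSSY2005 Ch. 11 (11.26)–(11.27) (the DLS/KLS sum rule); DysonLiebSimon1978 §1.
-/

noncomputable section

open MeasureTheory Complex WithLp
open scoped ENNReal NNReal ComplexConjugate BigOperators

namespace Summit.AtomisticToContinuum.BoseEinsteinCondensation.Theorems.BECInfraredBoundDepletionCounting

open Literature.MathematicalPhysics.QuantumManyBody.BoseGas

/-- `(x :: Y) - a⃗ = (x - a) :: (Y - a⃗)`. -/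
theorem vecCons_sub_const {n : ℕ} (x a : Space) (Y : Config n) :
    (Matrix.vecCons x Y - fun _ => a) = Matrix.vecCons (x - a) (Y - fun _ => a) := by
  ext i
  refine Fin.cases ?_ (fun j => ?_) i
  · simp
  · simp

/-- THE LEVER: occupations are jointly translation invariant,
`⟨φ(· − a), γ_{Ψ(· − a⃗)} φ(· − a)⟩ = ⟨φ, γ_Ψ φ⟩`. -/
theorem occupation_translate (N : ℕ) (φ : Space → ℂ) (Ψ : Config N → ℂ) (a : Space) :
    occupation N (fun x => φ (x - a)) (fun X => Ψ (X - fun _ => a)) = occupation N φ Ψ := by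
  cases N with
  | zero => rfl
  | succ n =>
    simp only [occupation]
    congr 1
    have hinner : ∀ Y : Config n,
        ∫ x, conj (φ (x - a)) * Ψ (Matrix.vecCons x Y - fun _ => a) =
          ∫ x, conj (φ x) * Ψ (Matrix.vecCons x (Y - fun _ => a)) := by
      intro Y
      simp_rw [vecCons_sub_const]
      exact integral_sub_right_eq_self
        (fun x => conj (φ x) * Ψ (Matrix.vecCons x (Y - fun _ => a))) a
    simp_rw [hinner]
    exact lintegral_sub_right_eq_self (μ := (volume : Measure (Config n)))
      (fun Y => (‖∫ x, conj (φ x) * Ψ (Matrix.vecCons x Y)‖₊ : ℝ≥0∞) ^ 2) (fun _ => a)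

/-- A unit phase on the MODE does not change the occupation. -/
theorem occupation_phase_mul_mode (N : ℕ) (φ : Space → ℂ) (Ψ : Config N → ℂ) {c : ℂ} (hc : ‖c‖ = 1) :
    occupation N (fun x => c * φ x) Ψ = occupation N φ Ψ := by
  cases N with
  | zero => rfl
  | succ n =>
    simp only [occupation]
    congr 1
    refine lintegral_congr fun Y => ?_
    have : ∫ x, conj (c * φ x) * Ψ (Matrix.vecCons x Y) =
        conj c * ∫ x, conj (φ x) * Ψ (Matrix.vecCons x Y) := by
      rw [← integral_const_mul]
      refine integral_congr_ae (Filter.Eventually.of_forall fun x => ?_)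
      simp only [map_mul]
      ring
    rw [this, nnnorm_mul]
    have hc' : ‖conj c‖₊ = 1 := by
      apply NNReal.coe_injective
      rw [coe_nnnorm, Complex.norm_conj, hc, NNReal.coe_one]
    rw [hc', one_mul]

/-- Pairing with an indicator-cut mode = restricted pairing. -/
theorem integral_conj_indicator_mul {s : Set Space} (hs : MeasurableSet s) (φ G : Space → ℂ) :
    ∫ x, conj (s.indicator φ x) * G x = ∫ x in s, conj (φ x) * G x := by
  rw [← integral_indicator hs]
  refine integral_congr_ae (Filter.Eventually.of_forall fun x => ?_)
  by_cases hx : x ∈ s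
  · simp [Set.indicator_of_mem hx]
  · simp [Set.indicator_of_notMem hx]

/-- FREE-SPECTATOR traced Parseval on the origin cell (spectators range over all of `Config n`):
`∑_{p ∈ ℤ³} ⟨1_cell φ_p, γ_Ψ 1_cell φ_p⟩ = (n+1) ∫ 1_cell(x₀) |Ψ(X)|² dX`. -/
theorem tsum_occupation_cellMode_eq {n : ℕ} {L : ℝ} (hL : 0 < L) {Ψ : Config (n + 1) → ℂ}
    (hΨ : Continuous Ψ) :
    ∑' p : Fin 3 → ℤ, occupation (n + 1) ((cell L).indicator (planeWaveMode L p)) Ψ =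
      ((n : ℝ≥0∞) + 1) *
        ∫⁻ X : Config (n + 1), (cell L).indicator (fun _ => (1 : ℝ≥0∞)) (X 0) * (‖Ψ X‖₊ : ℝ≥0∞) ^ 2 := by
  have hL3 : ENNReal.ofReal L ^ 3 ≠ 0 := pow_ne_zero _ (by simpa using hL)
  have hL3' : ENNReal.ofReal L ^ 3 ≠ ⊤ := ENNReal.pow_ne_top ENNReal.ofReal_ne_top
  have hslice : ∀ Y : Config n, Continuous fun x => Ψ (Matrix.vecCons x Y) := fun Y =>
    hΨ.comp (continuous_id.matrixVecCons continuous_const)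
  have hocc : ∀ p, occupation (n + 1) ((cell L).indicator (planeWaveMode L p)) Ψ =
      (n + 1 : ℝ≥0∞) * ∫⁻ Y : Config n,
        (‖∫ x in cell L, conj (planeWaveMode L p x) * Ψ (Matrix.vecCons x Y)‖₊ : ℝ≥0∞) ^ 2 := by
    intro p
    simp only [occupation]
    simp_rw [integral_conj_indicator_mul (measurableSet_cell L)]
  simp_rw [hocc]
  rw [ENNReal.tsum_mul_left, ← lintegral_tsum fun p =>
    (measurable_sliceInner (continuous_planeWaveMode L p) hΨ).aemeasurable]
  have hfib : ∀ Y : Config n,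
      ∑' p : Fin 3 → ℤ,
          (‖∫ x in cell L, conj (planeWaveMode L p x) * Ψ (Matrix.vecCons x Y)‖₊ : ℝ≥0∞) ^ 2 =
        ∫⁻ x in cell L, (‖Ψ (Matrix.vecCons x Y)‖₊ : ℝ≥0∞) ^ 2 := by
    intro Y
    simp only [nnnorm_sq_integral_conj_planeWaveMode_mul hL]
    rw [ENNReal.tsum_mul_left, tsum_sq_cellFourierCoeff hL (hslice Y), ← mul_assoc,
      ENNReal.mul_inv_cancel hL3 hL3', one_mul]
  simp_rw [hfib]
  have hF : Measurable fun X : Config (n + 1) =>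
      (cell L).indicator (fun _ => (1 : ℝ≥0∞)) (X 0) * (‖Ψ X‖₊ : ℝ≥0∞) ^ 2 := by
    refine Measurable.mul ?_ (hΨ.measurable.nnnorm.coe_nnreal_ennreal.pow_const _)
    exact (measurable_const.indicator (measurableSet_cell L)).comp (measurable_pi_apply 0)
  have hAE : AEMeasurable (Function.uncurry fun (x : Space) (Y : Config n) =>
      (cell L).indicator (fun _ => (1 : ℝ≥0∞)) ((Matrix.vecCons x Y : Config (n + 1)) 0) *
        (‖Ψ (Matrix.vecCons x Y)‖₊ : ℝ≥0∞) ^ 2) (volume.prod volume) :=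
    (hF.comp measurable_vecCons).aemeasurable
  have key : ∫⁻ X : Config (n + 1), (cell L).indicator (fun _ => (1 : ℝ≥0∞)) (X 0) * (‖Ψ X‖₊ : ℝ≥0∞) ^ 2
      = ∫⁻ Y : Config n, ∫⁻ x in cell L, (‖Ψ (Matrix.vecCons x Y)‖₊ : ℝ≥0∞) ^ 2 := by
    rw [← lintegral_lintegral_vecCons hF, lintegral_lintegral_swap hAE]
    refine lintegral_congr fun Y => ?_
    rw [← lintegral_indicator (measurableSet_cell L)]
    refine lintegral_congr fun x => ?_
    simp only [Matrix.cons_val_zero]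
    by_cases hx : x ∈ cell L
    · simp [Set.indicator_of_mem hx]
    · simp [Set.indicator_of_notMem hx]
  rw [key]

/-! ### Re-anchoring the inner cube at the origin

The shift vector `εL·𝟙 ∈ ℝ³` is used through an arbitrary `a : Space` with `∀ j, a j = εL`
(instantiated by `WithLp.toLp 2 (fun _ => εL)`), so that no auxiliary definition is needed. -/

/-- The half-open inner cube `∏ [εL, L-εL)` is the translate by `a = εL·𝟙` of the cell of side
`(1-2ε)L`. -/
theorem mem_innerIco_iff {L ε : ℝ} {a : Space} (ha : ∀ j, a j = ε * L) (x : Space) :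
    (∀ j, x j ∈ Set.Ico (ε * L) (L - ε * L)) ↔ x - a ∈ cell ((1 - 2 * ε) * L) := by
  simp only [cell, Set.mem_setOf_eq, Set.mem_Ico, PiLp.sub_apply, ha]
  refine forall_congr' fun j => ?_
  constructor <;> rintro ⟨h1, h2⟩ <;> constructor <;> linarith

/-- The crux's literal inner-cube plane wave of index `k` (half-open cube) is a unit phase times the
translated cell mode `1_cell φ_k (· - a)` of side `(1-2ε)L`, `a = εL·𝟙`. Pointwise, no null sets. -/
theorem innerMode_eq {L ε : ℝ} {a : Space} (ha : ∀ j, a j = ε * L) (k : Fin 3 → ℤ) :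
    ({x : Space | ∀ j, x j ∈ Set.Ico (ε * L) (L - ε * L)}.indicator fun x =>
        ((Real.sqrt (((1 - 2 * ε) * L) ^ 3))⁻¹ : ℂ) *
          Complex.exp (Complex.I * ↑(2 * Real.pi / ((1 - 2 * ε) * L) * ∑ j, (k j : ℝ) * x j))) =
      fun x => Complex.exp (↑(2 * Real.pi / ((1 - 2 * ε) * L) * ∑ j, (k j : ℝ) * (ε * L)) * Complex.I) *
        (cell ((1 - 2 * ε) * L)).indicator (planeWaveMode ((1 - 2 * ε) * L) k) (x - a) := by
  funext x
  by_cases hx : ∀ j, x j ∈ Set.Ico (ε * L) (L - ε * L)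
  · have hx' : x - a ∈ cell ((1 - 2 * ε) * L) := (mem_innerIco_iff ha x).1 hx
    rw [Set.indicator_of_mem (show x ∈ {x : Space | ∀ j, x j ∈ Set.Ico (ε * L) (L - ε * L)} from hx),
      Set.indicator_of_mem hx']
    simp only [planeWaveMode, PiLp.sub_apply, ha]
    conv_rhs => rw [mul_left_comm, ← Complex.exp_add]
    congr 1
    congr 1
    push_cast
    simp only [mul_sub, Finset.sum_sub_distrib]
    ring
  · have hx' : x - a ∉ cell ((1 - 2 * ε) * L) := fun h => hx ((mem_innerIco_iff ha x).2 h)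
    rw [Set.indicator_of_notMem (show x ∉ {x : Space | ∀ j, x j ∈ Set.Ico (ε * L) (L - ε * L)} from hx),
      Set.indicator_of_notMem hx', mul_zero]

/-- INNER-CUBE SUM RULE over all `k ∈ ℤ³` in the crux's literal mode family (half-open cube
`S = ∏[εL, L-εL)`; the crux's open cube differs from `S` by a null set, handled downstream by
`occupation_congr_ae` for the modes and by monotonicity `1_{Sᶜ} ≤ 1_{Λ'ᶜ}` for the shell):
`∑_k ⟨φ'_k, γ_Ψ φ'_k⟩ = (n+1) ∫ 1_S(x₀) |Ψ(X)|² dX` for every continuous `(n+1)`-body `Ψ`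
(the sum rule behind LSSY2005 Ch. 11 (11.26)). -/
theorem tsum_occupation_innerMode_eq {n : ℕ} {L ε : ℝ} (hL : 0 < L) (hε4 : ε < 1 / 2)
    {Ψ : Config (n + 1) → ℂ} (hΨ : Continuous Ψ) :
    ∑' k : Fin 3 → ℤ, occupation (n + 1)
        ({x : Space | ∀ j, x j ∈ Set.Ico (ε * L) (L - ε * L)}.indicator fun x =>
          ((Real.sqrt (((1 - 2 * ε) * L) ^ 3))⁻¹ : ℂ) *
            Complex.exp (Complex.I * ↑(2 * Real.pi / ((1 - 2 * ε) * L) * ∑ j, (k j : ℝ) * x j))) Ψ =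
      ((n : ℝ≥0∞) + 1) *
        ∫⁻ X : Config (n + 1),
          {x : Space | ∀ j, x j ∈ Set.Ico (ε * L) (L - ε * L)}.indicator
            (fun _ => (1 : ℝ≥0∞)) (X 0) * (‖Ψ X‖₊ : ℝ≥0∞) ^ 2 := by
  obtain ⟨a, ha⟩ : ∃ a : Space, ∀ j, a j = ε * L := ⟨toLp 2 fun _ => ε * L, fun _ => rfl⟩
  have hL' : 0 < (1 - 2 * ε) * L := mul_pos (by linarith) hL
  have hΨ'c : Continuous fun X : Config (n + 1) => Ψ (X + fun _ => a) :=
    hΨ.comp (continuous_id.add continuous_const)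
  have hback : (fun X : Config (n + 1) =>
      (fun X : Config (n + 1) => Ψ (X + fun _ => a)) (X - fun _ => a)) = Ψ := by
    funext X
    simp [sub_add_cancel]
  have hk : ∀ k : Fin 3 → ℤ, occupation (n + 1)
      ({x : Space | ∀ j, x j ∈ Set.Ico (ε * L) (L - ε * L)}.indicator fun x =>
          ((Real.sqrt (((1 - 2 * ε) * L) ^ 3))⁻¹ : ℂ) *
            Complex.exp (Complex.I * ↑(2 * Real.pi / ((1 - 2 * ε) * L) * ∑ j, (k j : ℝ) * x j))) Ψ =
        occupation (n + 1) ((cell ((1 - 2 * ε) * L)).indicator (planeWaveMode ((1 - 2 * ε) * L) k))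
          (fun X : Config (n + 1) => Ψ (X + fun _ => a)) := by
    intro k
    rw [innerMode_eq ha k]
    have h1 := occupation_phase_mul_mode (n + 1)
      (fun x => (cell ((1 - 2 * ε) * L)).indicator (planeWaveMode ((1 - 2 * ε) * L) k)
        (x - a)) Ψ
      (Complex.norm_exp_ofReal_mul_I (2 * Real.pi / ((1 - 2 * ε) * L) * ∑ j, (k j : ℝ) * (ε * L)))
    have h2 := occupation_translate (n + 1)
      ((cell ((1 - 2 * ε) * L)).indicator (planeWaveMode ((1 - 2 * ε) * L) k))
      (fun X : Config (n + 1) => Ψ (X + fun _ => a)) a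
    rw [hback] at h2
    exact h1.trans h2
  simp_rw [hk]
  rw [tsum_occupation_cellMode_eq hL' hΨ'c]
  congr 1
  have hG := lintegral_add_right_eq_self (μ := (volume : Measure (Config (n + 1))))
    (fun X => {x : Space | ∀ j, x j ∈ Set.Ico (ε * L) (L - ε * L)}.indicator
      (fun _ => (1 : ℝ≥0∞)) (X 0) * (‖Ψ X‖₊ : ℝ≥0∞) ^ 2) (fun _ => a)
  rw [← hG]
  refine lintegral_congr fun X => ?_
  simp only [Pi.add_apply]
  congr 1
  have hiff : (∀ j, (X 0 + a) j ∈ Set.Ico (ε * L) (L - ε * L)) ↔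
      X 0 ∈ cell ((1 - 2 * ε) * L) := by
    rw [mem_innerIco_iff ha, add_sub_cancel_right]
  by_cases hX : X 0 ∈ cell ((1 - 2 * ε) * L)
  · rw [Set.indicator_of_mem hX, Set.indicator_of_mem
      (show X 0 + a ∈ {x : Space | ∀ j, x j ∈ Set.Ico (ε * L) (L - ε * L)} from hiff.2 hX)]
  · rw [Set.indicator_of_notMem hX, Set.indicator_of_notMem
      (show X 0 + a ∉ {x : Space | ∀ j, x j ∈ Set.Ico (ε * L) (L - ε * L)} from
        fun h => hX (hiff.1 h))]

end Summit.AtomisticToContinuum.BoseEinsteinCondensation.Theorems.BECInfraredBoundDepletionCounting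

end
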